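import Summits.KontsevichZagierPeriods.KontsevichZagierPeriods.Theorems.SoloInformedNLCellData
import Literature.ModelTheory.ExponentialFields.CylindricalDecompositionProofs
import HarnessLib
import HarnessLib.Audit

/-!
# SoloInformed — the bands of an adapted cylindrical decomposition inside a closed band: index interval and telescoping (Newton–Leibniz elimination, file 4b)

Solo programme `solo-KontsevichZagierPeriods-informed`, session s245 (K-NF, `paper/nl-elimination.md`
§7.2, FILE 4b).

Setting.  `𝒯` is a finite partition of `ℝⁿ⁺¹` consisting exactly of the graphs `graphOver S (ξ S j)`
and bands `bandOver S (ξ S) j` of strictly increasing sections over the members `S` of a finite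
partition `𝒮` of `ℝⁿ` (the shape of a cylindrical decomposition, [BasuPollackRoy2006, Def. 5.1]),
and the closed band `KZlog.band τ a b = {(x, t) | x ∈ τ, a x ≤ t ≤ b x}` of a Newton–Leibniz
datum is a union of cells of `𝒯` (`𝒯` adapted to the band).  Fix a base cell `S ∈ 𝒮` with
`S ⊆ τ` and a point `x ∈ S`.

* `soloInformed_exists_section_eq_lower/upper`: `a x` and `b x` are section values `ξ S p x`,
  `ξ S q x`;
* `soloInformed_bounds_of_band_subset`: a band over `S` contained in the closed band is inner
  (`j ≠ 0`, `j ≠ last`) and its bounding sections satisfy `a x ≤ ξ_{j-1} x < ξ_j x ≤ b x`;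
* `soloInformed_band_subset_of_bounds`: conversely such a band lies in the closed band
  (adaptedness);
* `soloInformed_band_subset_iff`: the bands over `S` inside the closed band are exactly those
  with index
  `p < j ≤ q`;
* `soloInformed_band_telescope`: for every `Φ : ℝ → ℤ`,
  `∑_{bands j over S inside the closed band} (Φ(ξ_{j-1} x) − Φ(ξ_j x)) = Φ(a x) − Φ(b x)`.

With `Φ t = stepInd (F(x,t)) y` this is the fibrewise bookkeeping that turns the per-band signed
crossing numbers (LEMMA C, `SoloInformedCrossingNumber`) into the multiplicity
`sInd (F(x, a x)) (F(x, b x)) y` of the Newton–Leibniz right-hand side (FILE 4c).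

References: Basu–Pollack–Roy, *Algorithms in real algebraic geometry* (2006), Def. 5.1;
M. Kontsevich, D. Zagier, *Periods* (2001), §1.2; this work (THEOREM NF, `paper/nl-elimination.md`).
-/

noncomputable section

open scoped BigOperators Topology

namespace Summit.KontsevichZagierPeriods.KontsevichZagierPeriods.Theorems

open Set MeasureTheory Filter
open Literature.ModelTheory.ExponentialFields
open Literature.NumberTheory.Transcendental Literature.NumberTheory.Transcendental.KZ

variable {n : ℕ}

section Fibre

variable {𝒯 : Finset (Set (Fin (n + 1) → ℝ))} {𝒮 : Finset (Set (Fin n → ℝ))}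
  {lS : Set (Fin n → ℝ) → ℕ} {ξ : (S : Set (Fin n → ℝ)) → Fin (lS S) → (Fin n → ℝ) → ℝ}
  {τ : Set (Fin n → ℝ)} {a b : (Fin n → ℝ) → ℝ}
  {𝒞 : Finset (Set (Fin (n + 1) → ℝ))} {S : Set (Fin n → ℝ)} {x : Fin n → ℝ}

/-- If `(x, t) ∈ band τ a b` lies in no band over `S` contained in `band τ a b`, then `t` is a
section value over the base cell `S ∋ x` (the cell of `𝒯` containing `(x, t)` lies in the closed
band, is over the base cell of `x`, and is therefore a graph). -/
theorem soloInformed_exists_section_eq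
    (h𝒮 : Setoid.IsPartition (𝒮 : Set (Set (Fin n → ℝ))))
    (hmem : ∀ T, T ∈ 𝒯 ↔ ∃ S ∈ 𝒮, (∃ j, T = graphOver S (ξ S j)) ∨ ∃ j, T = bandOver S (ξ S) j)
    (h𝒞 : 𝒞 ⊆ 𝒯) (hU : ⋃₀ (𝒞 : Set (Set (Fin (n + 1) → ℝ))) = KZlog.band τ a b) (hS : S ∈ 𝒮)
    (hx : x ∈ S)
    {t : ℝ} (ht : (Fin.snoc x t : Fin (n + 1) → ℝ) ∈ KZlog.band τ a b)
    (hnot : ∀ j, (Fin.snoc x t : Fin (n + 1) → ℝ) ∈ bandOver S (ξ S) j →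
      ¬ bandOver S (ξ S) j ⊆ KZlog.band τ a b) :
    ∃ i : Fin (lS S), t = ξ S i x := by
  rw [← hU] at ht
  obtain ⟨T, hT𝒞, hzT⟩ := mem_sUnion.1 ht
  have hTB : T ⊆ KZlog.band τ a b := hU ▸ subset_sUnion_of_mem hT𝒞
  obtain ⟨S', hS', hT⟩ := (hmem T).1 (h𝒞 hT𝒞)
  have hSuniq : ∀ S' ∈ 𝒮, x ∈ S' → S' = S := by
    obtain ⟨U, -, huniq⟩ := h𝒮.2 x
    intro S' hS' hx'
    exact (huniq S' ⟨Finset.mem_coe.mpr hS', hx'⟩).trans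
      (huniq S ⟨Finset.mem_coe.mpr hS, hx⟩).symm
  rcases hT with ⟨j, rfl⟩ | ⟨j, rfl⟩
  · obtain ⟨hx', ht'⟩ := snoc_mem_graphOver_iff.1 hzT
    obtain rfl := hSuniq S' hS' hx'
    exact ⟨j, ht'⟩
  · obtain ⟨hx', -⟩ := snoc_mem_bandOver_iff.1 hzT
    obtain rfl := hSuniq S' hS' hx'
    exact absurd hTB (hnot j hzT)

/-- `a x` is a section value over the base cell `S ∋ x` (`S ⊆ τ`). -/
theorem soloInformed_exists_section_eq_lower
    (h𝒮 : Setoid.IsPartition (𝒮 : Set (Set (Fin n → ℝ))))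
    (hmem : ∀ T, T ∈ 𝒯 ↔ ∃ S ∈ 𝒮, (∃ j, T = graphOver S (ξ S j)) ∨ ∃ j, T = bandOver S (ξ S) j)
    (h𝒞 : 𝒞 ⊆ 𝒯) (hU : ⋃₀ (𝒞 : Set (Set (Fin (n + 1) → ℝ))) = KZlog.band τ a b) (hS : S ∈ 𝒮)
    (hSτ : S ⊆ τ)
    (hx : x ∈ S) (hab : a x ≤ b x) : ∃ p : Fin (lS S), ξ S p x = a x := by
  have ht : (Fin.snoc x (a x) : Fin (n + 1) → ℝ) ∈ KZlog.band τ a b :=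
    KZlog.snoc_mem_band.2 ⟨hSτ hx, le_rfl, hab⟩
  obtain ⟨i, hi⟩ := soloInformed_exists_section_eq h𝒮 hmem h𝒞 hU hS hx ht fun j hj hsub => by
    obtain ⟨-, hlo, hup⟩ := snoc_mem_bandOver_iff.1 hj
    obtain ⟨t', h1, h2⟩ := EReal.exists_between_coe_real hlo
    have hmemB := hsub (snoc_mem_bandOver_iff.2 ⟨hx, h1, lt_trans h2 hup⟩)
    have := (KZlog.snoc_mem_band.1 hmemB).2.1
    exact absurd this (not_le.2 (EReal.coe_lt_coe_iff.1 h2))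
  exact ⟨i, hi.symm⟩

/-- `b x` is a section value over the base cell `S ∋ x` (`S ⊆ τ`). -/
theorem soloInformed_exists_section_eq_upper
    (h𝒮 : Setoid.IsPartition (𝒮 : Set (Set (Fin n → ℝ))))
    (hmem : ∀ T, T ∈ 𝒯 ↔ ∃ S ∈ 𝒮, (∃ j, T = graphOver S (ξ S j)) ∨ ∃ j, T = bandOver S (ξ S) j)
    (h𝒞 : 𝒞 ⊆ 𝒯) (hU : ⋃₀ (𝒞 : Set (Set (Fin (n + 1) → ℝ))) = KZlog.band τ a b) (hS : S ∈ 𝒮)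
    (hSτ : S ⊆ τ)
    (hx : x ∈ S) (hab : a x ≤ b x) : ∃ q : Fin (lS S), ξ S q x = b x := by
  have ht : (Fin.snoc x (b x) : Fin (n + 1) → ℝ) ∈ KZlog.band τ a b :=
    KZlog.snoc_mem_band.2 ⟨hSτ hx, hab, le_rfl⟩
  obtain ⟨i, hi⟩ := soloInformed_exists_section_eq h𝒮 hmem h𝒞 hU hS hx ht fun j hj hsub => by
    obtain ⟨-, hlo, hup⟩ := snoc_mem_bandOver_iff.1 hj
    obtain ⟨t', h1, h2⟩ := EReal.exists_between_coe_real hup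
    have hmemB := hsub (snoc_mem_bandOver_iff.2 ⟨hx, lt_trans hlo h1, h2⟩)
    have := (KZlog.snoc_mem_band.1 hmemB).2.2
    exact absurd this (not_le.2 (EReal.coe_lt_coe_iff.1 h1))
  exact ⟨i, hi.symm⟩

/-- A band over `S` contained in the closed band is an inner band, bounded by sections with values
in `[a x, b x]`. -/
theorem soloInformed_bounds_of_band_subset
    (hmono : ∀ S ∈ 𝒮, ∀ x ∈ S, StrictMono fun j => ξ S j x)
    (hS : S ∈ 𝒮) (hx : x ∈ S) {j : Fin (lS S + 1)}
    (hj : bandOver S (ξ S) j ⊆ KZlog.band τ a b) :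
    ∃ (h0 : j ≠ 0) (hl : j ≠ Fin.last (lS S)),
      a x ≤ ξ S (j.pred h0) x ∧ ξ S (j.castPred hl) x ≤ b x := by
  have hm := hmono S hS x hx
  have hfib : ∀ t : ℝ, bandLower (ξ S) j x < t → (t : EReal) < bandUpper (ξ S) j x →
      a x ≤ t ∧ t ≤ b x := fun t h1 h2 =>
    (KZlog.snoc_mem_band.1 (hj (snoc_mem_bandOver_iff.2 ⟨hx, h1, h2⟩))).2
  obtain ⟨t₀, h₀l, h₀u⟩ := CylindricalDecomposition.exists_mem_band (ξ S) x hm j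
  have h0 : j ≠ 0 := by
    rintro rfl
    have hlt : min t₀ (a x) - 1 < t₀ := by linarith [min_le_left t₀ (a x)]
    have := (hfib (min t₀ (a x) - 1) (by rw [bandLower_zero]; exact EReal.bot_lt_coe _)
      (lt_trans (EReal.coe_lt_coe_iff.2 hlt) h₀u)).1
    linarith [min_le_right t₀ (a x)]
  have hl : j ≠ Fin.last (lS S) := by
    rintro rfl
    have hlt : t₀ < max t₀ (b x) + 1 := by linarith [le_max_left t₀ (b x)]
    have := (hfib (max t₀ (b x) + 1) (lt_trans h₀l (EReal.coe_lt_coe_iff.2 hlt))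
      (by rw [bandUpper_last]; exact EReal.coe_lt_top _)).2
    linarith [le_max_right t₀ (b x)]
  have hlt : ξ S (j.pred h0) x < ξ S (j.castPred hl) x := by
    apply hm
    rw [Fin.lt_def, Fin.val_pred, Fin.coe_castPred]
    have := Fin.val_ne_of_ne h0
    rw [Fin.val_zero] at this
    omega
  refine ⟨h0, hl, ?_, ?_⟩
  · by_contra hlt'
    rw [not_le] at hlt'
    obtain ⟨t, h1, h2⟩ := EReal.exists_between_coe_real
      (lt_min (EReal.coe_lt_coe_iff.2 hlt') (EReal.coe_lt_coe_iff.2 hlt))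
    obtain ⟨h2a, h2u⟩ := lt_min_iff.1 h2
    have := (hfib t (by rwa [bandLower_of_ne_zero (ξ S) j h0])
      (by rwa [bandUpper_of_ne_last (ξ S) j hl])).1
    exact absurd this (not_le.2 (EReal.coe_lt_coe_iff.1 h2a))
  · by_contra hlt'
    rw [not_le] at hlt'
    obtain ⟨t, h1, h2⟩ := EReal.exists_between_coe_real
      (max_lt (EReal.coe_lt_coe_iff.2 hlt') (EReal.coe_lt_coe_iff.2 hlt))
    obtain ⟨h1b, h1l⟩ := max_lt_iff.1 h1
    have := (hfib t (by rwa [bandLower_of_ne_zero (ξ S) j h0])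
      (by rwa [bandUpper_of_ne_last (ξ S) j hl])).2
    exact absurd this (not_le.2 (EReal.coe_lt_coe_iff.1 h1b))

/-- Conversely, an inner band over `S ⊆ τ` whose bounding sections take values in `[a x, b x]` at
some point `x ∈ S` meets the closed band, hence lies in it (adaptedness). -/
theorem soloInformed_band_subset_of_bounds
    (h𝒯 : Setoid.IsPartition (𝒯 : Set (Set (Fin (n + 1) → ℝ))))
    (hmono : ∀ S ∈ 𝒮, ∀ x ∈ S, StrictMono fun j => ξ S j x)
    (hmem : ∀ T, T ∈ 𝒯 ↔ ∃ S ∈ 𝒮, (∃ j, T = graphOver S (ξ S j)) ∨ ∃ j, T = bandOver S (ξ S) j)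
    (h𝒞 : 𝒞 ⊆ 𝒯) (hU : ⋃₀ (𝒞 : Set (Set (Fin (n + 1) → ℝ))) = KZlog.band τ a b) (hS : S ∈ 𝒮)
    (hSτ : S ⊆ τ)
    (hx : x ∈ S) {j : Fin (lS S + 1)} (h0 : j ≠ 0) (hl : j ≠ Fin.last (lS S))
    (ha : a x ≤ ξ S (j.pred h0) x) (hb : ξ S (j.castPred hl) x ≤ b x) :
    bandOver S (ξ S) j ⊆ KZlog.band τ a b := by
  have hm := hmono S hS x hx
  have hlt : ξ S (j.pred h0) x < ξ S (j.castPred hl) x := by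
    apply hm
    rw [Fin.lt_def, Fin.val_pred, Fin.coe_castPred]
    have := Fin.val_ne_of_ne h0
    rw [Fin.val_zero] at this
    omega
  have hT : bandOver S (ξ S) j ∈ 𝒯 := (hmem _).2 ⟨S, hS, Or.inr ⟨j, rfl⟩⟩
  refine soloInformed_cell_subset_of_not_disjoint h𝒯 h𝒞 hU hT (not_disjoint_iff.2 ?_)
  set t : ℝ := (ξ S (j.pred h0) x + ξ S (j.castPred hl) x) / 2 with ht
  refine ⟨Fin.snoc x t, (snoc_mem_bandOver_iff_of_ne h0 hl).2 ⟨hx, ?_, ?_⟩,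
    KZlog.snoc_mem_band.2 ⟨hSτ hx, ?_, ?_⟩⟩
  · rw [ht]; linarith
  · rw [ht]; linarith
  · rw [ht]; linarith
  · rw [ht]; linarith

/-- The bands over the base cell `S ∋ x` contained in the closed band are exactly the inner bands
with index `p < j ≤ q`, where `ξ S p x = a x` and `ξ S q x = b x`. -/
theorem soloInformed_band_subset_iff
    (h𝒯 : Setoid.IsPartition (𝒯 : Set (Set (Fin (n + 1) → ℝ))))
    (hmono : ∀ S ∈ 𝒮, ∀ x ∈ S, StrictMono fun j => ξ S j x)
    (hmem : ∀ T, T ∈ 𝒯 ↔ ∃ S ∈ 𝒮, (∃ j, T = graphOver S (ξ S j)) ∨ ∃ j, T = bandOver S (ξ S) j)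
    (h𝒞 : 𝒞 ⊆ 𝒯) (hU : ⋃₀ (𝒞 : Set (Set (Fin (n + 1) → ℝ))) = KZlog.band τ a b) (hS : S ∈ 𝒮)
    (hSτ : S ⊆ τ)
    (hx : x ∈ S) {p q : Fin (lS S)} (hp : ξ S p x = a x) (hq : ξ S q x = b x)
    (j : Fin (lS S + 1)) :
    bandOver S (ξ S) j ⊆ KZlog.band τ a b ↔ (p : ℕ) < j ∧ (j : ℕ) ≤ q := by
  have hm := hmono S hS x hx
  constructor
  · intro hj
    obtain ⟨h0, hl, ha, hb⟩ := soloInformed_bounds_of_band_subset hmono hS hx hj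
    rw [← hp] at ha
    rw [← hq] at hb
    have h1 : p ≤ j.pred h0 := hm.le_iff_le.1 ha
    have h2 : j.castPred hl ≤ q := hm.le_iff_le.1 hb
    rw [Fin.le_def, Fin.val_pred] at h1
    rw [Fin.le_def, Fin.coe_castPred] at h2
    have := Fin.val_ne_of_ne h0
    rw [Fin.val_zero] at this
    exact ⟨by omega, h2⟩
  · rintro ⟨h1, h2⟩
    have h0 : j ≠ 0 := by
      intro h; rw [h, Fin.val_zero] at h1; exact Nat.not_lt_zero _ h1
    have hl : j ≠ Fin.last (lS S) := by
      intro h; rw [h, Fin.val_last] at h2; exact absurd (lt_of_le_of_lt h2 q.isLt) (lt_irrefl _)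
    refine soloInformed_band_subset_of_bounds h𝒯 hmono hmem h𝒞 hU hS hSτ hx h0 hl ?_ ?_
    · rw [← hp]
      apply hm.monotone
      rw [Fin.le_def, Fin.val_pred]
      omega
    · rw [← hq]
      apply hm.monotone
      rw [Fin.le_def, Fin.coe_castPred]
      exact h2

/-- If `a x < b x` then some band over the base cell `S ∋ x` lies in the closed band. -/
theorem soloInformed_exists_band_subset_of_lt
    (h𝒯 : Setoid.IsPartition (𝒯 : Set (Set (Fin (n + 1) → ℝ))))
    (h𝒮 : Setoid.IsPartition (𝒮 : Set (Set (Fin n → ℝ))))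
    (hmono : ∀ S ∈ 𝒮, ∀ x ∈ S, StrictMono fun j => ξ S j x)
    (hmem : ∀ T, T ∈ 𝒯 ↔ ∃ S ∈ 𝒮, (∃ j, T = graphOver S (ξ S j)) ∨ ∃ j, T = bandOver S (ξ S) j)
    (h𝒞 : 𝒞 ⊆ 𝒯) (hU : ⋃₀ (𝒞 : Set (Set (Fin (n + 1) → ℝ))) = KZlog.band τ a b) (hS : S ∈ 𝒮)
    (hSτ : S ⊆ τ)
    (hx : x ∈ S) (hab : a x < b x) : ∃ j, bandOver S (ξ S) j ⊆ KZlog.band τ a b := by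
  have hm := hmono S hS x hx
  obtain ⟨p, hp⟩ := soloInformed_exists_section_eq_lower h𝒮 hmem h𝒞 hU hS hSτ hx hab.le
  obtain ⟨q, hq⟩ := soloInformed_exists_section_eq_upper h𝒮 hmem h𝒞 hU hS hSτ hx hab.le
  have hpq : p < q := hm.lt_iff_lt.1 (by rw [hp, hq]; exact hab)
  refine ⟨⟨(p : ℕ) + 1, by omega⟩, ?_⟩
  rw [soloInformed_band_subset_iff h𝒯 hmono hmem h𝒞 hU hS hSτ hx hp hq]
  rw [Fin.lt_def] at hpq
  exact ⟨by simp, by simpa using hpq⟩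

/-- **Fibrewise telescoping.**  For the base cell `S ∋ x` (`S ⊆ τ`, `a x ≤ b x`) and every
`Φ : ℝ → ℤ`, summing `Φ(lower section) − Φ(upper section)` over the bands over `S` contained in the
closed band gives `Φ (a x) − Φ (b x)`.  (The real endpoints are read off the `EReal`-valued
`bandLower`/`bandUpper`, whose values on the bands in question are finite.) -/
theorem soloInformed_band_telescope
    (h𝒯 : Setoid.IsPartition (𝒯 : Set (Set (Fin (n + 1) → ℝ))))
    (h𝒮 : Setoid.IsPartition (𝒮 : Set (Set (Fin n → ℝ))))
    (hmono : ∀ S ∈ 𝒮, ∀ x ∈ S, StrictMono fun j => ξ S j x)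
    (hmem : ∀ T, T ∈ 𝒯 ↔ ∃ S ∈ 𝒮, (∃ j, T = graphOver S (ξ S j)) ∨ ∃ j, T = bandOver S (ξ S) j)
    (h𝒞 : 𝒞 ⊆ 𝒯) (hU : ⋃₀ (𝒞 : Set (Set (Fin (n + 1) → ℝ))) = KZlog.band τ a b) (hS : S ∈ 𝒮)
    (hSτ : S ⊆ τ)
    (hx : x ∈ S) (hab : a x ≤ b x) (Φ : ℝ → ℤ) (Bd : Finset (Fin (lS S + 1)))
    (hBd : ∀ j, j ∈ Bd ↔ bandOver S (ξ S) j ⊆ KZlog.band τ a b) :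
    ∑ j ∈ Bd, (Φ (bandLower (ξ S) j x).toReal - Φ (bandUpper (ξ S) j x).toReal) =
      Φ (a x) - Φ (b x) := by
  have hm := hmono S hS x hx
  obtain ⟨p, hp⟩ := soloInformed_exists_section_eq_lower h𝒮 hmem h𝒞 hU hS hSτ hx hab
  obtain ⟨q, hq⟩ := soloInformed_exists_section_eq_upper h𝒮 hmem h𝒞 hU hS hSτ hx hab
  have hpq : p ≤ q := hm.le_iff_le.1 (by rw [hp, hq]; exact hab)
  -- the sections as a sequence indexed by `ℕ`
  set sN : ℕ → ℝ := fun m => if h : m < lS S then ξ S ⟨m, h⟩ x else 0 with hsN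
  have hsN_apply : ∀ i : Fin (lS S), sN i = ξ S i x := fun i => by
    rw [hsN]; simp only [Fin.is_lt, dif_pos, Fin.eta]
  -- rewrite the index set and the summand numerically
  have hBd' : Bd = Finset.univ.filter fun j : Fin (lS S + 1) => (p : ℕ) < j ∧ (j : ℕ) ≤ q := by
    ext j
    rw [hBd, Finset.mem_filter,
      soloInformed_band_subset_iff h𝒯 hmono hmem h𝒞 hU hS hSτ hx hp hq]
    simp
  have hsummand : ∀ j ∈ Bd, Φ (bandLower (ξ S) j x).toReal - Φ (bandUpper (ξ S) j x).toReal =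
      Φ (sN ((j : ℕ) - 1)) - Φ (sN j) := by
    intro j hj
    obtain ⟨h0, hl, -, -⟩ := soloInformed_bounds_of_band_subset hmono hS hx ((hBd j).1 hj)
    rw [bandLower_of_ne_zero (ξ S) j h0, bandUpper_of_ne_last (ξ S) j hl, EReal.toReal_coe,
      EReal.toReal_coe]
    have e1 : sN ((j : ℕ) - 1) = ξ S (j.pred h0) x := by
      rw [← hsN_apply]; simp only [Fin.val_pred]
    have e2 : sN j = ξ S (j.castPred hl) x := by
      rw [← hsN_apply]; simp only [Fin.coe_castPred]
    rw [e1, e2]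
  rw [Finset.sum_congr rfl hsummand, hBd', Finset.sum_filter,
    Fin.sum_univ_eq_sum_range (fun m => if (p : ℕ) < m ∧ m ≤ (q : ℕ) then
      Φ (sN (m - 1)) - Φ (sN m) else 0) (lS S + 1), ← Finset.sum_filter]
  have hIco : (Finset.range (lS S + 1)).filter (fun m => (p : ℕ) < m ∧ m ≤ (q : ℕ)) =
      Finset.Ico ((p : ℕ) + 1) ((q : ℕ) + 1) := by
    ext m
    simp only [Finset.mem_filter, Finset.mem_range, Finset.mem_Ico]
    have := q.isLt
    omega
  rw [hIco, Finset.sum_Ico_eq_sum_range]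
  have hlen : (q : ℕ) + 1 - ((p : ℕ) + 1) = (q : ℕ) - (p : ℕ) := by omega
  rw [hlen]
  have hstep : ∀ k ∈ Finset.range ((q : ℕ) - (p : ℕ)),
      Φ (sN ((p : ℕ) + 1 + k - 1)) - Φ (sN ((p : ℕ) + 1 + k)) =
        Φ (sN ((p : ℕ) + k)) - Φ (sN ((p : ℕ) + (k + 1))) := by
    intro k _
    have e1 : (p : ℕ) + 1 + k - 1 = (p : ℕ) + k := by omega
    have e2 : (p : ℕ) + 1 + k = (p : ℕ) + (k + 1) := by omega
    rw [e1, e2]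
  rw [Finset.sum_congr rfl hstep, Finset.sum_range_sub' (fun k => Φ (sN ((p : ℕ) + k))),
    add_zero, Nat.add_sub_cancel' (Fin.le_def.1 hpq), hsN_apply, hsN_apply, hp, hq]

end Fibre

end Summit.KontsevichZagierPeriods.KontsevichZagierPeriods.Theorems
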